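import Literature.AnabelianGeometry.SemiGraphs.CoveringRestrictRelabel
import Literature.AnabelianGeometry.SemiGraphs.DecompositionGroupGeneral
import Literature.AnabelianGeometry.SemiGraphs.CoveringGlobalProofs
import Literature.AnabelianGeometry.SemiGraphs.CommensurableTerminalityLemmas

/-!
# The decomposition group of the restricted covering `𝒢_A|_{φ⁻¹ℍ} → 𝒢|_ℍ` ([SemiAnbd] Cor. 2.7 (i))

Mochizuki, *Semi-graphs of anabelioids*, Publ. RIMS **42** (2006), §2 p. 30, proof of Cor. 2.7 (i):
"there exists a connected finite Galois étale covering `𝒢′ → 𝒢` — whose restriction to `ℍ` … we denote by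
`ℋ′ → ℍ`" and Remark 2.2.1 p. 24 (decomposition groups are stabilisers)
[cite: MochizukiSemiAnbd2006, Cor. 2.7(i) p.30].  abc-iut cell, layer L3, row «D3b (CORE)» (abc-iut-w4-d071;
four-way cut of abc-iut-L3-lead's RULINGS α7-1: (T) abc-iut-L6-t17, (CORE) this file, (COMP) abc-iut-L3-d3,
(ASM) abc-iut-w5-d041).  PROOF-ONLY file (no `def`).

**(CORE).**  Let `𝒢` be connected, `A ∈ B(𝒢)` GALOIS, `φ := A.coveringHomCan : 𝒢_A → 𝒢` the constructed
covering (abc-iut-L3-t5), `ℍ ⊆ 𝔾` any sub-semi-graph, `K̄ := φ⁻¹ℍ ⊆ 𝔾_A` its whole preimage and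
`ψ̄ := φ|_{K̄} : 𝒢_A|_{K̄} → 𝒢|_ℍ` (abc-iut-L6-t17's `Hom.restrict`).  For a base vertex `x` of `K̄` (over
`v ∈ ℍ`) and basepoints `F′` of `(𝒢_A)_x`, `F` of `𝒢_v`, `e : φ_x^* ⋙ F′ ≅ F`, write
`ι : Π_{𝒢_A} → Π_𝒢` and `ι_{ψ̄} : Π_{K̄} → Π_ℍ` for the induced homomorphisms (the `ι` of the dictionary
item (D1), abc-iut-L3-d3's `FiniteEtaleCoveringDictionary.lean`).  THEN

  `range ι_{ψ̄} = (range ι).comap (Π_ℍ → Π_𝒢)`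

— the decomposition group of the restricted covering is the pull-back of the decomposition group
(`range_ι_restrict_preimage_eq_comap`).  Proof: (D1′) without connectedness
(`covering_decompositionGroup_of_isGlobalCoveringOf`, `DecompositionGroupGeneral.lean`) applied to `φ`
gives `range ι = Stab_{Π_𝒢}(x₀)`, and applied to abc-iut-L3-t5's covering `č : (𝒢|_ℍ)_{A|_ℍ} → 𝒢|_ℍ` of
`𝒢|_ℍ` attached to `A|_ℍ` (global clause `coveringHomCan_isGlobalCoveringOf`; its source is disconnected in
general, whence (D1′)) gives `range ι_č = Stab_{Π_ℍ}(s)`; the relabelling `range ι_{ψ̄} = range ι_č`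
(`range_ι_restrict_preimage_eq`, `CoveringRestrictRelabel.lean`); `Π_ℍ` acts on `F(A_v)` through
`Π_ℍ → Π_𝒢`, so `Stab_{Π_ℍ}(s)` is the pull-back of `Stab_{Π_𝒢}(s)`; and since `A` is GALOIS all points of
`F(A_v)` have the same stabiliser in `Π_𝒢` (`stabilizer_eq_of_isGalois`), `Stab_{Π_𝒢}(s) = Stab_{Π_𝒢}(x₀) =
range ι` — no base-point matching is needed.  Consumers: with abc-iut-L6-t17's bridge (T1) and
abc-iut-L3-d3's component passage (COMP), clause (P3) of (D3) at `coveringHomCan` is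
`map (Π_ℍ → Π_𝒢) (comap (Π_ℍ → Π_𝒢) (range ι)) = range ι ⊓ Π_ℍ` (`Subgroup.map_comap_eq`).
Honest framing: nothing here bears on [IUTchIII] Cor. 3.12.
-/

namespace Literature.AnabelianGeometry.SemiGraphs

open CategoryTheory CategoryTheory.Limits CategoryTheory.PreGaloisCategory
open Literature.AnabelianGeometry.Anabelioids

universe v₁ u₁ u

namespace SemiGraphOfAnabelioids

variable {𝒢 : SemiGraphOfAnabelioids.{v₁, u₁, u}}

/-- The stabiliser in `Π_ℍ` of a point of the fibre `F(A_v)` of `A|_ℍ` is the pull-back along `Π_ℍ → Π_𝒢`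
of its stabiliser in `Π_𝒢` (`Π_ℍ` acts through `Π_ℍ → Π_𝒢`, definitionally).
[cite: MochizukiSemiAnbd2006, Def. 2.1 p.24] -/
theorem stabilizer_restrict_eq_comap_piHToPi (H : 𝒢.graph.Subgraph) (v : H.toSemiGraph.Vertex)
    (F : 𝒢.V v.1 ⥤ FintypeCat.{v₁}) (A : 𝒢.BObj) (s : (𝒢.ρ v.1 ⋙ F).obj A) :
    MulAction.stabilizer ((𝒢.restrict H).Pi v F)
        (show ((𝒢.restrict H).ρ v ⋙ F).obj ((𝒢.restrictFunctor H).obj A) from s) =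
      (MulAction.stabilizer (𝒢.Pi v.1 F) s).comap (𝒢.piHToPi H v F) := by
  ext h
  rfl

/-- **(CORE) The decomposition group of the restricted covering is the pull-back of the decomposition
group.**  For `𝒢` connected, `A ∈ B(𝒢)` Galois, `φ := A.coveringHomCan`, `ℍ ⊆ 𝔾`, `K̄ := φ⁻¹ℍ`,
`ψ̄ := φ|_{K̄} : 𝒢_A|_{K̄} → 𝒢|_ℍ`, a base vertex `x` of `K̄` over `v ∈ ℍ`, basepoints `F′`, `F` and
`e : φ_x^* ⋙ F′ ≅ F`:  `range ι_{ψ̄} = (range ι).comap (Π_ℍ → Π_𝒢)` (notation of the module docstring;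
`ι`, `ι_{ψ̄}` in the shape of the dictionary item (D1)). [cite: MochizukiSemiAnbd2006, Cor. 2.7(i) p.30] -/
theorem range_ι_restrict_preimage_eq_comap (hc : 𝒢.IsConnected) (A : 𝒢.BObj)
    (hA : @IsGalois 𝒢.BObj _ (𝒢.galoisCategory_bObj hc) A) (H : 𝒢.graph.Subgraph)
    (x : (⟨A.coveringHomCan.base.vertexMap ⁻¹' H.verts, A.coveringHomCan.base.edgeMap ⁻¹' H.edges⟩ :
      A.coveringGraph.graph.Subgraph).toSemiGraph.Vertex)
    (F' : A.coveringGraph.V x.1 ⥤ FintypeCat.{v₁}) [FiberFunctor F']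
    (F : 𝒢.V (A.coveringHomCan.base.vertexMap x.1) ⥤ FintypeCat.{v₁}) [FiberFunctor F]
    (e : (A.coveringHomCan.φV x.1).pullback ⋙ F' ≅ F) :
    let K : A.coveringGraph.graph.Subgraph :=
      ⟨A.coveringHomCan.base.vertexMap ⁻¹' H.verts, A.coveringHomCan.base.edgeMap ⁻¹' H.edges⟩
    let ψ : Hom (A.coveringGraph.restrict K) (𝒢.restrict H) :=
      A.coveringHomCan.restrict K H (fun _ h => h) (fun _ h => h)
    let v : H.toSemiGraph.Vertex := ⟨A.coveringHomCan.base.vertexMap x.1, x.2⟩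
    let ι : A.coveringGraph.Pi x.1 F' →* 𝒢.Pi (A.coveringHomCan.base.vertexMap x.1) F :=
      (Aut.autMulEquivOfIso
          (Functor.isoWhiskerLeft (𝒢.ρ (A.coveringHomCan.base.vertexMap x.1)) e)).toMonoidHom.comp
        (pi1Map A.coveringHomCan.pullbackFunctor (A.coveringGraph.ρ x.1 ⋙ F'))
    let ιψ : (A.coveringGraph.restrict K).Pi x F' →* (𝒢.restrict H).Pi v F :=
      (Aut.autMulEquivOfIso (Functor.isoWhiskerLeft ((𝒢.restrict H).ρ v) e)).toMonoidHom.comp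
        (pi1Map ψ.pullbackFunctor ((A.coveringGraph.restrict K).ρ x ⋙ F'))
    ιψ.range = ι.range.comap (𝒢.piHToPi H v F) := by
  intro K ψ v ι ιψ
  -- (1) the decomposition group of `φ` is the stabiliser of a point `x₀ ∈ F(A_v)` ((D1′))
  obtain ⟨x₀, -, hx₀⟩ := covering_decompositionGroup_of_isGlobalCoveringOf A.coveringHomCan A
    A.coveringHomCan_isGlobalCoveringOf x.1 F' F e
  -- (2) the covering `č` of `𝒢|_ℍ` attached to `A|_ℍ`: its decomposition group is `Stab_{Π_ℍ}(s)` ((D1′));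
  --     `F′` is a fibre functor of the common constituent `(𝒢_A)_x = ((𝒢|_ℍ)_{A|_ℍ})_{x″}`
  let x'' : ((𝒢.restrictFunctor H).obj A).coveringGraph.graph.Vertex := ⟨v, x.1.2⟩
  let F'' : ((𝒢.restrictFunctor H).obj A).coveringGraph.V x'' ⥤ FintypeCat.{v₁} := F'
  haveI : FiberFunctor F'' := ‹FiberFunctor F'›
  obtain ⟨s, -, hs⟩ := covering_decompositionGroup_of_isGlobalCoveringOf
    ((𝒢.restrictFunctor H).obj A).coveringHomCan ((𝒢.restrictFunctor H).obj A)
    ((𝒢.restrictFunctor H).obj A).coveringHomCan_isGlobalCoveringOf x'' F'' F e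
  -- (3) the relabelling `range ι_{ψ̄} = range ι_č`
  have hrel := range_ι_restrict_preimage_eq A H x F' F e
  change ιψ.range = _ at hrel
  rw [hrel]
  refine (show _ = MulAction.stabilizer ((𝒢.restrict H).Pi v F)
    (show ((𝒢.restrict H).ρ v ⋙ F).obj ((𝒢.restrictFunctor H).obj A) from s) from hs).trans ?_
  -- (4) all points of `F(A_v)` have the stabiliser `range ι` in `Π_𝒢` (`A` Galois)
  letI := 𝒢.galoisCategory_bObj hc
  haveI := 𝒢.fiberFunctor_ρ hc (A.coveringHomCan.base.vertexMap x.1) F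
  haveI : IsGalois A := hA
  have hst : MulAction.stabilizer (𝒢.Pi (A.coveringHomCan.base.vertexMap x.1) F)
      (show (𝒢.ρ (A.coveringHomCan.base.vertexMap x.1) ⋙ F).obj A from s) = ι.range := by
    rw [hx₀]
    exact stabilizer_eq_of_isGalois (𝒢.ρ (A.coveringHomCan.base.vertexMap x.1) ⋙ F) A _ x₀
  -- (5) `Π_ℍ` acts through `Π_ℍ → Π_𝒢`
  rw [← hst]
  exact stabilizer_restrict_eq_comap_piHToPi H v F A s

end SemiGraphOfAnabelioids

end Literature.AnabelianGeometry.SemiGraphs
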